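import Literature.Combinatorics.Additive.PopularDifferencesEnergy

/-!
# Popular differences of a set with small product set in `𝔽_p` (elementary, via sum–product)

Topic `Literature/Combinatorics/Additive`. Everything here is PROVED; no definitions, no named facts.

**Theorem** (`popular_difference_le_of_small_productset`). There are absolute `κ₀ ∈ (0, 1]`,
`C, c > 0` such that for every prime `p`, every zero-free `A ⊆ 𝔽_p` with `|A|² ≤ 2p`, every
`K ≥ 1` with `|A·A| ≤ K|A|` and every `d ≠ 0`,

  `r_{A−A}(d) = #{(a, a') ∈ A² : a − a' = d} ≤ C · K^c · |A|^{1 − κ₀}`.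

So a set with small product set has no popular difference. This replaces, with a weaker but
ELEMENTARY exponent, the Stevens–de Zeeuw incidence route (`popular_difference_le_of_sdz`,
conditional on the named fact `stevensDeZeeuw_thm4`) in sector A of the crux `DlogGraphFlat`
(`Summits/QuantumAdvantage`; its registered stub `stub_dlogPopularDiff` is the implication
"sum–product ⇒ this statement", `stub_dlogSpreadOfPD` consumes it).

Proof (folklore; the milieu is Bourgain–Glibichuk–Konyagin 2006 / Garaev 2007). Suppose
`r > |A|^{1−κ₀}`. With `X = AA` (`|A| ≤ |X| ≤ K|A|`):
1. `E₊(X) ≥ |A| r²` (`card_mul_repr_sq_le_addEnergy_mul`), i.e. `E₊(X) ≥ |X|³/K_B` with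
   `K_B = K³|A|²/r² < K³|A|^{2κ₀}`;
2. Balog–Szemerédi–Gowers (`Zhao2023_thm7136_holds`, PROVED in the tree): `X' ⊆ X` with
   `|X| ≤ Q|X'|`, `|X' + X'| ≤ Q|X'|`, `Q = C₁K_B^{C₁}`;
3. `|X'X'| ≤ |XX| ≤ K⁴|A|` (Plünnecke–Ruzsa in `𝔽_pˣ`, `card_mul_mul_mul_card_pow_le`);
4. a subset `X'' ⊆ X'` of size `min(|X'|, ⌊|A|/2⌋) ≥ |A|/(4Q)` has `|X''|² < p` and both doubling
   constants `≤ 4K⁴Q²`, so the sum–product theorem (`card_le_of_small_sumset_and_productset`)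
   gives `|X''| ≤ C₀(4K⁴Q²)³²`, whence `|A| ≤ C₀4³³K¹²⁸Q⁶⁵`;
5. with `κ₀ = 1/(260 C₁)` the bookkeeping (`pd_numerics`) yields `|A| ≤ C'K^{c'}`, and then
   `r ≤ |A| = |A|^{κ₀}|A|^{1−κ₀} ≤ (C'K^{c'})^{κ₀}|A|^{1−κ₀}`.
-/

namespace Literature.Combinatorics.Additive

open Finset
open scoped Pointwise Combinatorics.Additive

section PDMain

/-- Real bookkeeping of the popular-difference bound: from `N^{1−κ₀} < R` (`N ≥ 1`),
`κ₀ = 1/(260 C₁)` and `N ≤ C₀ 4³³ K¹²⁸ (C₁ (K³N²/R²)^{C₁})⁶⁵` conclude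
`N ≤ (C₀ 4³³ C₁⁶⁵)² K^{2(128 + 195 C₁)}`. [folklore] -/
theorem pd_numerics (C₀ C₁ K N R : ℝ) (hC₀ : 1 ≤ C₀) (hC₁ : 1 ≤ C₁) (hK : 1 ≤ K) (hN : 1 ≤ N)
    (hR0 : 0 < R) (hR : N ^ (1 - 1 / (260 * C₁)) < R)
    (hmain : N ≤ C₀ * 4 ^ 33 * K ^ 128 * (C₁ * (K ^ 3 * N ^ 2 / R ^ 2) ^ C₁) ^ 65) :
    N ≤ (C₀ * 4 ^ 33 * C₁ ^ 65) ^ 2 * K ^ (2 * (128 + 195 * C₁)) := by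
  set κ₀ : ℝ := 1 / (260 * C₁) with hκ₀
  have hC₁0 : 0 < C₁ := by linarith
  have hκ₀pos : 0 < κ₀ := by positivity
  have hN0 : 0 < N := by linarith
  have hK0 : 0 < K := by linarith
  have hNκ : ∀ t : ℝ, 0 < N ^ t := fun t => Real.rpow_pos_of_pos hN0 t
  -- (1)  N²/R² ≤ N^{2κ₀}
  have h1 : N ^ 2 / R ^ 2 ≤ N ^ (2 * κ₀) := by
    have hR2 : (N ^ (1 - κ₀)) ^ 2 ≤ R ^ 2 := pow_le_pow_left₀ (hNκ _).le hR.le 2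
    have e : (N ^ (1 - κ₀)) ^ 2 * N ^ (2 * κ₀) = N ^ 2 := by
      rw [← Real.rpow_natCast (N ^ (1 - κ₀)) 2, ← Real.rpow_mul hN0.le, ← Real.rpow_add hN0]
      have hexp : (1 - κ₀) * ((2 : ℕ) : ℝ) + 2 * κ₀ = ((2 : ℕ) : ℝ) := by push_cast; ring
      rw [hexp, Real.rpow_natCast]
    rw [div_le_iff₀ (by positivity), ← e]
    exact mul_le_mul_of_nonneg_right hR2 (hNκ _).le |>.trans_eq (by ring)
  -- (2)  KB ≤ K³ N^{2κ₀},  Q ≤ C₁ K^{3C₁} N^{2κ₀C₁}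
  set KB : ℝ := K ^ 3 * N ^ 2 / R ^ 2 with hKB
  have hKB0 : 0 ≤ KB := by positivity
  have hKB1 : KB ≤ K ^ 3 * N ^ (2 * κ₀) := by
    rw [hKB, mul_div_assoc]; exact mul_le_mul_of_nonneg_left h1 (by positivity)
  have hQ : C₁ * KB ^ C₁ ≤ C₁ * (K ^ (3 * C₁) * N ^ (2 * κ₀ * C₁)) := by
    refine mul_le_mul_of_nonneg_left ?_ hC₁0.le
    calc KB ^ C₁ ≤ (K ^ 3 * N ^ (2 * κ₀)) ^ C₁ := Real.rpow_le_rpow hKB0 hKB1 hC₁0.le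
      _ = (K ^ 3) ^ C₁ * (N ^ (2 * κ₀)) ^ C₁ := Real.mul_rpow (by positivity) (hNκ _).le
      _ = K ^ (3 * C₁) * N ^ (2 * κ₀ * C₁) := by
          rw [← Real.rpow_natCast K 3, ← Real.rpow_mul hK0.le, ← Real.rpow_mul hN0.le]
          norm_num
  have hQ0 : 0 ≤ C₁ * KB ^ C₁ := by positivity
  -- (3)  Q^65 ≤ C₁^65 K^{195 C₁} N^{1/2}
  have h130 : 2 * κ₀ * C₁ * 65 = 1 / 2 := by
    rw [hκ₀]; field_simp; ring
  have hQ65 : (C₁ * KB ^ C₁) ^ 65 ≤ C₁ ^ 65 * K ^ (195 * C₁) * N ^ (1 / 2 : ℝ) := by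
    calc (C₁ * KB ^ C₁) ^ 65 ≤ (C₁ * (K ^ (3 * C₁) * N ^ (2 * κ₀ * C₁))) ^ 65 :=
          pow_le_pow_left₀ hQ0 hQ 65
      _ = C₁ ^ 65 * ((K ^ (3 * C₁)) ^ 65 * (N ^ (2 * κ₀ * C₁)) ^ 65) := by ring
      _ = C₁ ^ 65 * K ^ (195 * C₁) * N ^ (1 / 2 : ℝ) := by
          rw [← Real.rpow_natCast (K ^ (3 * C₁)) 65, ← Real.rpow_mul hK0.le,
            ← Real.rpow_natCast (N ^ (2 * κ₀ * C₁)) 65, ← Real.rpow_mul hN0.le]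
          have e1 : 3 * C₁ * ((65 : ℕ) : ℝ) = 195 * C₁ := by push_cast; ring
          have e2 : 2 * κ₀ * C₁ * ((65 : ℕ) : ℝ) = 1 / 2 := by push_cast; exact h130
          rw [e1, e2]; ring
  -- (4)  N ≤ M · N^{1/2}
  set M : ℝ := C₀ * 4 ^ 33 * C₁ ^ 65 * (K ^ 128 * K ^ (195 * C₁)) with hM
  have hM0 : 0 ≤ M := by positivity
  have h4 : N ≤ M * N ^ (1 / 2 : ℝ) := by
    calc N ≤ C₀ * 4 ^ 33 * K ^ 128 * (C₁ * KB ^ C₁) ^ 65 := hmain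
      _ ≤ C₀ * 4 ^ 33 * K ^ 128 * (C₁ ^ 65 * K ^ (195 * C₁) * N ^ (1 / 2 : ℝ)) :=
          mul_le_mul_of_nonneg_left hQ65 (by positivity)
      _ = M * N ^ (1 / 2 : ℝ) := by rw [hM]; ring
  -- (5)  N^{1/2} ≤ M, hence N ≤ M²
  have hsq : N ^ (1 / 2 : ℝ) * N ^ (1 / 2 : ℝ) = N := by
    rw [← Real.rpow_add hN0]; norm_num
  have h5 : N ^ (1 / 2 : ℝ) ≤ M := by
    have h : N ^ (1 / 2 : ℝ) * N ^ (1 / 2 : ℝ) ≤ M * N ^ (1 / 2 : ℝ) := by rw [hsq]; exact h4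
    exact le_of_mul_le_mul_right h (hNκ _)
  have h6 : N ≤ M ^ 2 := by
    calc N = N ^ (1 / 2 : ℝ) * N ^ (1 / 2 : ℝ) := hsq.symm
      _ ≤ M * M := mul_le_mul h5 h5 (hNκ _).le hM0
      _ = M ^ 2 := by ring
  -- (6)  M² = (C₀ 4³³ C₁⁶⁵)² K^{2(128+195C₁)}
  have hKpow : K ^ 128 * K ^ (195 * C₁) = K ^ (128 + 195 * C₁) := by
    rw [← Real.rpow_natCast K 128, ← Real.rpow_add hK0]; norm_num
  have hK2 : (K ^ 128 * K ^ (195 * C₁)) ^ 2 = K ^ (2 * (128 + 195 * C₁)) := by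
    rw [hKpow, ← Real.rpow_natCast (K ^ (128 + 195 * C₁)) 2, ← Real.rpow_mul hK0.le]
    congr 1; push_cast; ring
  have hM2 : M ^ 2 = (C₀ * 4 ^ 33 * C₁ ^ 65) ^ 2 * K ^ (2 * (128 + 195 * C₁)) := by
    rw [hM, ← hK2]; ring
  rw [hM2] at h6
  exact h6

/-- **Popular differences of a set with small product set** (elementary): absolute
`κ₀ ∈ (0,1]`, `C, c > 0` with `r_{A−A}(d) ≤ C K^c |A|^{1−κ₀}` for every prime `p`, zero-free
`A ⊆ ZMod p` with `|A|² ≤ 2p`, `|AA| ≤ K|A|` (`K ≥ 1`) and `d ≠ 0`. [folklore] -/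
theorem popular_difference_le_of_small_productset :
    ∃ κ₀ : ℝ, 0 < κ₀ ∧ κ₀ ≤ 1 ∧ ∃ C : ℝ, 0 < C ∧ ∃ c : ℝ, 0 < c ∧
      ∀ (p : ℕ) [Fact (Nat.Prime p)] (A : Finset (ZMod p)) (K : ℝ),
      (0 : ZMod p) ∉ A → 1 ≤ K → (A.card : ℝ) ^ 2 ≤ 2 * (p : ℝ) →
      ((A * A).card : ℝ) ≤ K * A.card → ∀ d : ZMod p, d ≠ 0 →
      ((((A ×ˢ A).filter fun x : ZMod p × ZMod p => x.1 - x.2 = d).card : ℝ)) ≤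
        C * K ^ c * (A.card : ℝ) ^ (1 - κ₀) := by
  obtain ⟨CB, hCB, hBSG⟩ := Zhao2023_thm7136_holds
  set C₁ : ℝ := max CB 1 with hC₁
  have hC₁1 : 1 ≤ C₁ := le_max_right _ _
  have hCBC₁ : CB ≤ C₁ := le_max_left _ _
  have hC₁0 : 0 < C₁ := by linarith
  set C₀ : ℝ := 8 * 12 ^ 6 with hC₀
  have hC₀1 : 1 ≤ C₀ := by norm_num
  set κ₀ : ℝ := 1 / (260 * C₁) with hκ₀
  have hκ₀pos : 0 < κ₀ := by positivity
  have hκ₀1 : κ₀ ≤ 1 := by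
    rw [hκ₀, div_le_one (by positivity)]; linarith
  have hκ₀lt : κ₀ < 1 := by
    rw [hκ₀, div_lt_one (by positivity)]; linarith
  set C' : ℝ := (C₀ * 4 ^ 33 * C₁ ^ 65) ^ 2 with hC'
  have hC'1 : 1 ≤ C' := by
    rw [hC']
    have : (1 : ℝ) ≤ C₀ * 4 ^ 33 * C₁ ^ 65 := by
      have h1 : (1 : ℝ) ≤ 4 ^ 33 := by norm_num
      have h2 : (1 : ℝ) ≤ C₁ ^ 65 := one_le_pow₀ hC₁1
      calc (1 : ℝ) = 1 * 1 * 1 := by ring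
        _ ≤ C₀ * 4 ^ 33 * C₁ ^ 65 := by gcongr
    nlinarith
  set c' : ℝ := 2 * (128 + 195 * C₁) with hc'
  have hc'0 : 0 < c' := by positivity
  refine ⟨κ₀, hκ₀pos, hκ₀1, max 4 (C' ^ κ₀), by positivity, c' * κ₀, by positivity, ?_⟩
  intro p hpf A K hA0 hK hp2 hAA d hd
  classical
  have hK0 : 0 < K := by linarith
  set N : ℕ := A.card with hN
  set r : ℕ := ((A ×ˢ A).filter fun x : ZMod p × ZMod p => x.1 - x.2 = d).card with hr
  have hrN : r ≤ N := card_filter_sub_eq_le_card A d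
  have hrNR : (r : ℝ) ≤ N := by exact_mod_cast hrN
  have hCmax1 : (1 : ℝ) ≤ max 4 (C' ^ κ₀) := le_trans (by norm_num) (le_max_left _ _)
  have hKc : (1 : ℝ) ≤ K ^ (c' * κ₀) := Real.one_le_rpow hK (by positivity)
  have hCK : (1 : ℝ) ≤ max 4 (C' ^ κ₀) * K ^ (c' * κ₀) := one_le_mul_of_one_le_of_one_le hCmax1 hKc
  -- empty A
  by_cases hAne : A.Nonempty
  swap
  · rw [Finset.not_nonempty_iff_eq_empty] at hAne
    have : r = 0 := by
      have : N = 0 := by rw [hN, hAne, Finset.card_empty]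
      omega
    rw [this]; push_cast; positivity
  have hN1 : (1 : ℝ) ≤ N := by exact_mod_cast hAne.card_pos
  have hN0 : (0 : ℝ) < N := by linarith
  have hNpow0 : 0 < (N : ℝ) ^ (1 - κ₀) := Real.rpow_pos_of_pos hN0 _
  -- the easy case
  by_cases hcase : (r : ℝ) ≤ (N : ℝ) ^ (1 - κ₀)
  · calc (r : ℝ) ≤ (N : ℝ) ^ (1 - κ₀) := hcase
      _ = 1 * (N : ℝ) ^ (1 - κ₀) := (one_mul _).symm
      _ ≤ max 4 (C' ^ κ₀) * K ^ (c' * κ₀) * (N : ℝ) ^ (1 - κ₀) :=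
          mul_le_mul_of_nonneg_right hCK hNpow0.le
  push Not at hcase
  -- now N^{1-κ₀} < r ≤ N, so 2 ≤ N
  have hr0 : (0 : ℝ) < r := hNpow0.trans hcase
  have h2N : 2 ≤ N := by
    by_contra h
    have hN1' : N = 1 := by
      have := hAne.card_pos; rw [← hN] at this; omega
    have : (N : ℝ) ^ (1 - κ₀) = 1 := by rw [hN1']; simp
    rw [this] at hcase
    have : (r : ℝ) ≤ 1 := by rw [hN1'] at hrNR; exact_mod_cast hrNR
    linarith
  -- X = AA
  set X := A * A with hX
  have hX0 : (0 : ZMod p) ∉ X := zero_not_mem_mul A A hA0 hA0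
  have hNX : N ≤ X.card := card_le_card_mul_self_of_zero_not_mem A hA0 hAne
  have hNXR : (N : ℝ) ≤ X.card := by exact_mod_cast hNX
  have hXne : X.Nonempty := Finset.card_pos.mp (by omega)
  -- energy
  have hE : (N : ℝ) * ((r : ℝ) * r) ≤ (Finset.addEnergy X X : ℝ) := by
    exact_mod_cast card_mul_repr_sq_le_addEnergy_mul A hA0 hd
  set KB : ℝ := K ^ 3 * (N : ℝ) ^ 2 / (r : ℝ) ^ 2 with hKB
  have hKB1 : 1 ≤ KB := by
    rw [hKB, one_le_div (by positivity)]
    have h1 : (r : ℝ) ^ 2 ≤ (N : ℝ) ^ 2 := pow_le_pow_left₀ hr0.le hrNR 2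
    have h2 : (1 : ℝ) ≤ K ^ 3 := one_le_pow₀ hK
    exact h1.trans (le_mul_of_one_le_left (sq_nonneg _) h2)
  have hKB0 : 0 < KB := by linarith
  have hEB : (X.card : ℝ) ^ 3 / KB ≤ Finset.addEnergy X X := by
    rw [div_le_iff₀ hKB0]
    calc (X.card : ℝ) ^ 3 ≤ (K * N) ^ 3 := pow_le_pow_left₀ (Nat.cast_nonneg _) hAA 3
      _ = (N : ℝ) * ((r : ℝ) * r) * KB := by rw [hKB]; field_simp
      _ ≤ (Finset.addEnergy X X : ℝ) * KB := mul_le_mul_of_nonneg_right hE hKB0.le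
  -- BSG
  obtain ⟨X', hX'X, hB1, hB2⟩ := hBSG (ZMod p) X KB hXne hKB1 hEB
  set Q : ℝ := C₁ * KB ^ C₁ with hQ
  have hKBC : KB ^ CB ≤ KB ^ C₁ := Real.rpow_le_rpow_of_exponent_le hKB1 hCBC₁
  have hCBKB : CB * KB ^ CB ≤ Q := by
    rw [hQ]; exact mul_le_mul hCBC₁ hKBC (by positivity) hC₁0.le
  have hQ1 : 1 ≤ Q := by
    rw [hQ]; exact one_le_mul_of_one_le_of_one_le hC₁1 (Real.one_le_rpow hKB1 hC₁0.le)
  have hQ0 : 0 < Q := by linarith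
  have hB1' : (X.card : ℝ) ≤ Q * X'.card := hB1.trans (mul_le_mul_of_nonneg_right hCBKB (Nat.cast_nonneg _))
  have hB2' : ((X' + X').card : ℝ) ≤ Q * X'.card := hB2.trans (mul_le_mul_of_nonneg_right hCBKB (Nat.cast_nonneg _))
  have hX'pos : (0 : ℝ) < X'.card := by
    by_contra h
    push Not at h
    have : (X'.card : ℝ) = 0 := le_antisymm h (Nat.cast_nonneg _)
    rw [this, mul_zero] at hB1'
    linarith
  have hX'N : (N : ℝ) ≤ Q * X'.card := hNXR.trans hB1'
  -- the truncated subset X''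
  set t : ℕ := N / 2 with ht
  have ht4 : N ≤ 4 * t := by omega
  have ht2 : 2 * t ≤ N := by omega
  have htR : (N : ℝ) ≤ 4 * t := by exact_mod_cast ht4
  obtain ⟨X'', hX''X', hX''card⟩ := Finset.exists_subset_card_eq (s := X') (n := min X'.card t)
    (min_le_left _ _)
  have hX''X : X'' ⊆ X := hX''X'.trans hX'X
  have hX''0 : (0 : ZMod p) ∉ X'' := fun h => hX0 (hX''X h)
  have hmpos : 0 < X''.card := by
    rw [hX''card, Nat.lt_min]
    constructor
    · exact_mod_cast hX'pos
    · omega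
  have hX''ne : X''.Nonempty := Finset.card_pos.mp hmpos
  have hX''p : (X''.card : ℝ) ^ 2 < p := by
    have h1 : X''.card ≤ t := by rw [hX''card]; exact min_le_right _ _
    have h2 : (2 * X''.card) ^ 2 ≤ N ^ 2 := Nat.pow_le_pow_left (by omega) 2
    have h3 : ((N ^ 2 : ℕ) : ℝ) ≤ 2 * p := by push_cast; exact hp2
    have h4 : (((2 * X''.card) ^ 2 : ℕ) : ℝ) ≤ 2 * p := le_trans (by exact_mod_cast h2) h3
    push_cast at h4
    have hp0 : (0 : ℝ) < p := by exact_mod_cast hpf.out.pos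
    have e : (2 * (X''.card : ℝ)) ^ 2 = 4 * (X''.card : ℝ) ^ 2 := by ring
    rw [e] at h4
    linarith
  -- |X''| ≥ N/(4Q)
  have hm : (N : ℝ) ≤ 4 * Q * X''.card := by
    rw [hX''card]
    rcases le_total X'.card t with h | h
    · rw [min_eq_left h]
      calc (N : ℝ) ≤ Q * X'.card := hX'N
        _ ≤ 4 * Q * X'.card := by
            have h0 : 0 ≤ Q * X'.card := mul_nonneg hQ0.le hX'pos.le
            linarith
    · rw [min_eq_right h]
      calc (N : ℝ) ≤ 4 * t := htR
        _ = 4 * 1 * t := by ring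
        _ ≤ 4 * Q * t := by gcongr
  -- doubling constants of X''
  set Ksp : ℝ := 4 * K ^ 4 * Q ^ 2 with hKsp
  have hKsp1 : 1 ≤ Ksp := by
    rw [hKsp]
    have h1 : (1 : ℝ) ≤ K ^ 4 := one_le_pow₀ hK
    have h2 : (1 : ℝ) ≤ Q ^ 2 := one_le_pow₀ hQ1
    have h4 : (1 : ℝ) ≤ 4 := by norm_num
    exact one_le_mul_of_one_le_of_one_le (one_le_mul_of_one_le_of_one_le h4 h1) h2
  have hX'KN : (X'.card : ℝ) ≤ K * N :=
    le_trans (by exact_mod_cast Finset.card_le_card hX'X) hAA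
  have hadd : ((X'' + X'').card : ℝ) ≤ Ksp * X''.card := by
    calc ((X'' + X'').card : ℝ) ≤ (X' + X').card := by
          exact_mod_cast Finset.card_le_card (Finset.add_subset_add hX''X' hX''X')
      _ ≤ Q * X'.card := hB2'
      _ ≤ Q * (K * N) := mul_le_mul_of_nonneg_left hX'KN hQ0.le
      _ ≤ Q * (K * (4 * Q * X''.card)) := by gcongr
      _ = (4 * K * Q ^ 2) * X''.card := by ring
      _ ≤ Ksp * X''.card := by
          rw [hKsp]
          refine mul_le_mul_of_nonneg_right ?_ (Nat.cast_nonneg _)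
          have hK4 : K ≤ K ^ 4 := le_self_pow₀ hK (by norm_num)
          have h44 : 4 * K ≤ 4 * K ^ 4 := mul_le_mul_of_nonneg_left hK4 (by norm_num)
          exact mul_le_mul_of_nonneg_right h44 (sq_nonneg Q)
  have hXX : ((X * X).card : ℝ) ≤ K ^ 4 * N := by
    have h1 : (((X * X).card * N ^ 4 : ℕ) : ℝ) ≤ ((X.card ^ 4 * N : ℕ) : ℝ) := by
      exact_mod_cast card_mul_mul_mul_card_pow_le A hA0 hAne
    push_cast at h1
    have h2 : (X.card : ℝ) ^ 4 * N ≤ (K * N) ^ 4 * N :=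
      mul_le_mul_of_nonneg_right (pow_le_pow_left₀ (Nat.cast_nonneg _) hAA 4) (Nat.cast_nonneg _)
    have h3 : ((X * X).card : ℝ) * (N : ℝ) ^ 4 ≤ (K ^ 4 * N) * (N : ℝ) ^ 4 := by
      calc _ ≤ (K * N) ^ 4 * N := h1.trans h2
        _ = (K ^ 4 * N) * (N : ℝ) ^ 4 := by ring
    exact le_of_mul_le_mul_right h3 (by positivity)
  have hmul : ((X'' * X'').card : ℝ) ≤ Ksp * X''.card := by
    calc ((X'' * X'').card : ℝ) ≤ (X * X).card := by
          exact_mod_cast Finset.card_le_card (Finset.mul_subset_mul hX''X hX''X)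
      _ ≤ K ^ 4 * N := hXX
      _ ≤ K ^ 4 * (4 * Q * X''.card) := by gcongr
      _ = (4 * K ^ 4 * Q) * X''.card := by ring
      _ ≤ Ksp * X''.card := by
          rw [hKsp]
          refine mul_le_mul_of_nonneg_right ?_ (Nat.cast_nonneg _)
          have hQ2 : Q ≤ Q ^ 2 := le_self_pow₀ hQ1 (by norm_num)
          exact mul_le_mul_of_nonneg_left hQ2 (by positivity)
  -- sum–product on X''
  have hSP := card_le_of_small_sumset_and_productset X'' Ksp hX''0 hX''ne hKsp1 hX''p hadd hmul
  -- N ≤ C₀ 4³³ K¹²⁸ Q⁶⁵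
  have hmain : (N : ℝ) ≤ C₀ * 4 ^ 33 * K ^ 128 * (C₁ * KB ^ C₁) ^ 65 := by
    rw [← hQ]
    calc (N : ℝ) ≤ 4 * Q * X''.card := hm
      _ ≤ 4 * Q * (8 * 12 ^ 6 * Ksp ^ 32) :=
          mul_le_mul_of_nonneg_left hSP (by linarith [hQ0])
      _ = C₀ * 4 ^ 33 * K ^ 128 * Q ^ 65 := by rw [hKsp, hC₀]; ring
  have hfin := pd_numerics C₀ C₁ K N r hC₀1 hC₁1 hK hN1 hr0 hcase hmain
  rw [← hC', ← hc'] at hfin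
  -- r ≤ N = N^{κ₀} N^{1-κ₀} ≤ (C' K^{c'})^{κ₀} N^{1-κ₀}
  have hsplit : (N : ℝ) = (N : ℝ) ^ κ₀ * (N : ℝ) ^ (1 - κ₀) := by
    rw [← Real.rpow_add hN0]; simp
  have hNκ : (N : ℝ) ^ κ₀ ≤ C' ^ κ₀ * K ^ (c' * κ₀) := by
    calc (N : ℝ) ^ κ₀ ≤ (C' * K ^ c') ^ κ₀ := Real.rpow_le_rpow hN0.le hfin hκ₀pos.le
      _ = C' ^ κ₀ * (K ^ c') ^ κ₀ := Real.mul_rpow (by linarith) (by positivity)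
      _ = C' ^ κ₀ * K ^ (c' * κ₀) := by rw [← Real.rpow_mul hK0.le]
  calc (r : ℝ) ≤ N := hrNR
    _ = (N : ℝ) ^ κ₀ * (N : ℝ) ^ (1 - κ₀) := hsplit
    _ ≤ (C' ^ κ₀ * K ^ (c' * κ₀)) * (N : ℝ) ^ (1 - κ₀) :=
        mul_le_mul_of_nonneg_right hNκ hNpow0.le
    _ ≤ (max 4 (C' ^ κ₀) * K ^ (c' * κ₀)) * (N : ℝ) ^ (1 - κ₀) := by
        refine mul_le_mul_of_nonneg_right ?_ hNpow0.le
        exact mul_le_mul_of_nonneg_right (le_max_right _ _) (by positivity)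

end PDMain

end Literature.Combinatorics.Additive
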